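import Summits.QuantumFields.BalabanUV.Beta.D1BFx.DressedColumnRibbon

/-!
# `BalabanUV.Beta.D1BFx.PackedColumnEnvelopeSplit` — road «BF-x» for binder row D1, slot (K) ∕ junction (J1), PART 24 HEAD row (lamf): **«G0-COL-ENV-INTERIOR» —
# THE INTERIOR ∕ FACE SPLIT OF THE ROAD's DRESSED COLUMN ENVELOPE, IN SITE LANGUAGE: off the face layer of its block the bm-dressed one-shot column
# `colH G₀ n μ y α x` (`G₀ := coDressKBmAt (ctr 4 n) n (KInvStep 3 n 0)`) is `(n⁵)⁻¹·C_int′·e^{−(κ′∕(4n))|x − n•y|₁}`, on it `(n⁴)⁻¹·C_G′·e^{−(κ′∕(4n))|x − n•y|₁}` —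
# EXACTLY the `hint` ∕ `hface` binders of d1-leaf-03's split socket `SymCorrectorFaceWeightSplit.abs_faceWeight_le_mass_split` (TT29) at the record predicate
# `P x := ∃ i, off n x i = 0 ∨ off n x i = n − 1`, with every constant DISPLAYED**

HONEST DEPENDENCY (cell records, verbatim): «continuum YM on T⁴ ⇐ BetaPertH ∧ nine spine estimates (0/9 proved); BetaPertH ⇐ (D1) ∧ (D4) ∧
CAP+tail; G-an2-4 gates asym, D1 and NE2/3/4.»  HONEST FRAMING (cell contract, verbatim): «discharging `BetaPertH` makes Bałaban's UV stability
UNCONDITIONAL — a real constructive-QFT result; it is NOT the continuum limit and NOT the Clay problem.»  THIS MODULE DISCHARGES NOTHING of the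
wall: [folklore] block geometry over lit `AveragingContours.blk_add_off ∕ blk_block ∕ off_mem_box` plus TWO LANDED column letters BY NAME — d1-leaf-01 g30's
L-h♭ `DressedColumnRibbon.abs_colH_G₀_road_interior_le` (interior bonds, `(n⁵)⁻¹`) and this lineage's g53 «G0-COL-ENV» `PackedColumnEnvelope.abs_colH_G₀_road_le`
(all bonds, `(n⁴)⁻¹`).  No definition, no `def … : Prop`, nothing cited, NO printed hypothesis, 0 sorry.  It is a WEIGHT LETTER: it prices NO word and proves
NO (1.22) row; 0 root-level binders of row D1 discharged (hW ∕ hR-sockets ∕ hSX-socket ∕ D1Tel ∕ D1Rep = 0); (J1) ONE OPEN ROW; (K) NOT closed; NOT D1, NEVER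
«G-an2-4 closed», NOT `BetaPertH`, NOT continuum, NOT Clay.

ABSOLUTE RULE (cell charter, verbatim): «No internally-minted statement may enter as a cited fact. Every hypothesis is either kernel-proved in
this package or a verbatim quotation of a PUBLISHED theorem with page reference. The manuscript(s) under audit are NOT citable for their own
disputed steps — they are the thing under adjudication; programme-internal (2001/route/tribunal) claims are never citable.»

WHY (the OWNER d1-p2 g25, W-g25-8 (a), journal l.54937: «NEW WANTED «G0-COL-ENV-INTERIOR» — the interior∕face SPLIT of the dressed column envelope
(`|colH G₀ n μ y κ x| ≤ (n⁵)⁻¹·C·e^{…}` off the faces of its block, `(n⁴)⁻¹` on them) in your `PackedColumnEnvelope` lane — it is THE letter that makes row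
(lamf) m-uniform»; d1-leaf-03 g33's N-1 Q-1 ∕ PS l.54904 and TT29 INTENT-5 l.55069).  The face gauge generator `Λf[G₀]` of the HEAD's row (lamf) reads the
face weight at scalar `n⁴∕2` through the dressed column; one envelope over the whole block gives the face-sheet power `(n⁴)⁻¹` against a block mass `≍ n`
— the row reads `≍ n`.  Split the block's SITES into the face layer `P` and its complement: off `P` every forward bond `(α, x)` has both endpoints in the
block of `x`, where L-h♭ gives `(n⁵)⁻¹` (against the mass `≍ n`); on `P` the booked `(n⁴)⁻¹` meets the face-layer mass `O(1)` (leaf-03 TT30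
`FaceWeightMasses.faceLayerMass_smul_faceWt_le` over leaf-01 `DshFaceMass.sum_faces_abs_lam04_le`) — `Ci·Bi + Cf·Bf = O(n⁻⁴)·|ξ|`, `O(1)` at `ξ = n⁴∕2`.

CONTENT.
* §1 [folklore, generic `d`, `1 ≤ L`] the face-layer geometry in SITE language (`off L x` = lit `AveragingContours.off`): **`blk_add_unitVec_of_off_lt`** (`off L x κ + 1 < L →
  blk L (x + e_κ) = blk L x`), **`blk_add_unitVec_of_off_ne`** (`off L x κ ≠ L − 1 → …`), **`blk_sub_unitVec_of_off_ne_zero`** (`off L x κ ≠ 0 → blk L (x − e_κ) = blk L x`),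
  **`blk_add_unitVec_of_not_face`** (`¬(∃ i, off L x i = 0 ∨ off L x i = L − 1) → ∀ κ, blk L (x + e_κ) = blk L x`) and its backward twin **`blk_sub_unitVec_of_not_face`**.
* §2 [our objects, `d = 3`, `[NeZero n]`, the HEAD's pin `G₀ := coDressKBmAt (ctr 4 n) n (KInvStep 3 n 0)`, constants `C_int′ := 8·(MD163 4·periodConst (kappa163 4) 3)·e^{κ′}`,
  `C_G′ := (MG163 4·periodConst (kappa163 4) 3)·(1 + 8(1 + e^{κ′}))·e^{κ′}`, `κ′ := kappa163 4∕4`, rate `κ′∕(4n)`]: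
  **`abs_colH_G₀_pin_le_of_off_ne`** (per direction: `off n x α ≠ n − 1` suffices for `(n⁵)⁻¹·C_int′`), **`abs_colH_G₀_pin_interior_le`** (TT29's `hint` VERBATIM:
  `∀ α x, ¬(∃ i, off n x i = 0 ∨ off n x i = n − 1) → |colH G₀ n μ y α x| ≤ ((n⁵)⁻¹·C_int′) * Real.exp (-(κ′∕(4n)) * l1 (x − n•y))`), **`abs_colH_G₀_pin_le`** (every site,
  `(n⁴)⁻¹·C_G′`), **`abs_colH_G₀_pin_face_le`** (TT29's `hface` VERBATIM, any predicate), the slots **`pin_interior_weight_nonneg`** ∕ **`pin_face_weight_nonneg`** ∕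
  **`pin_rate_nonneg`** (TT29's `hCi ∕ hCf ∕ hδ`), and **`abs_colH_G₀_pin_le_min_of_off_ne`** (off the far face both letters hold: `≤ min Ci Cf · e^{−δ|x − n•y|₁}`).
NOT typed here: TT29's record instance (leaf-03's, on word), the masses `Bi ∕ Bf` (leaf-03 TT30), any row of the HEAD.  Unit `b2b-balaban-gan24-formalise-leaf-05`
(gen 63), road «BF-x»; the OWNER's WANTED «G0-COL-ENV-INTERIOR».  Not in print; our bookkeeping.  No existing file touched.
-/

noncomputable section

namespace Summit.QuantumFields.BalabanUV.Beta.D1BFx.PackedColumnEnvelopeSplit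

open Finset
open scoped BigOperators
open Literature.MathematicalPhysics.QuantumFieldTheory
open Literature.MathematicalPhysics.QuantumFieldTheory.Balaban1983to89
open Literature.MathematicalPhysics.QuantumFieldTheory.Balaban1983to89.Beta
open B12Sec2to5 (l1 l1_nonneg)
open B4TorusKernel (periodConst)
open B5Hk163Strip (kappa163 kappa163_pos)
open B5Hk163Decay (MG163)
open B5Hk163TorusHolderDecay (MD163)
open AffineAveraging (Site box toSite unitVec unitVec_apply)
open AveragingContours (blk off blk_add_off blk_block off_mem_box)
open AveragingContoursRooted (ctr ctrOff ctrOff_mem_box)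
open OneStepKernelFamily (colH KInvStep)
open Summit.QuantumFields.BalabanUV.Beta.AxialDressingRooted (coDressKBmAt)
open Summit.QuantumFields.BalabanUV.Beta.D1BFx.PackedColumnEnvelope (abs_colH_G₀_road_le colH_G₀_road_weight_nonneg)
open Summit.QuantumFields.BalabanUV.Beta.D1BFx.DressedColumnRibbon (abs_colH_G₀_road_interior_le)
open Summit.QuantumFields.BalabanUV.Beta.D1BFx.MinimiserColumnGradient (colH_KInvStep_zero_diff_road_weight_nonneg)

/-! ## §1 The face layer of a block, in site language (generic `d`) -/

section Geometry

variable {d : ℕ} {L : ℕ}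

/-- [folklore] **A FORWARD BOND BELOW THE FAR FACE STAYS IN ITS BLOCK**: if the offset of `x` in direction `κ` satisfies `off L x κ + 1 < L`, then
`blk L (x + e_κ) = blk L x` (site-language sibling of `GAN24.StaircaseFaces.blk_add_unitVec_of_not_dvd` (divisibility) and `KernelWardHColumnSym.blk_add_unitVec_of_isIntBond`
(`bIdxSet`), neither in this file's import closure; proved from lit `blk_add_off` ∕ `blk_block`). -/
theorem blk_add_unitVec_of_off_lt (hL : 1 ≤ L) (x : Site d) (κ : Fin d) (h : off L x κ + 1 < L) :
    blk L (x + unitVec κ) = blk L x := by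
  have hx : (L : ℤ) • blk L x + toSite (off L x) = x := blk_add_off hL x
  have hb : off L x ∈ box d L := off_mem_box hL x
  have hb' : Function.update (off L x) κ (off L x κ + 1) ∈ box d L := by
    rw [AffineAveraging.box, Fintype.mem_piFinset] at hb ⊢
    intro i
    rw [Finset.mem_range]
    by_cases hi : i = κ
    · subst hi; rw [Function.update_self]; exact h
    · rw [Function.update_of_ne hi]; exact Finset.mem_range.1 (hb i)
  have e1 : toSite (Function.update (off L x) κ (off L x κ + 1)) = toSite (off L x) + unitVec κ := by
    funext i
    simp only [toSite, Pi.add_apply, unitVec_apply, Function.update_apply]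
    split_ifs with hi
    · subst hi; push_cast; ring
    · simp
  have e : x + unitVec κ = (L : ℤ) • blk L x + toSite (Function.update (off L x) κ (off L x κ + 1)) := by
    rw [e1, ← add_assoc, hx]
  rw [e, blk_block (blk L x) hb']

/-- [folklore] **OFF THE FAR FACE, THE FORWARD BOND STAYS IN THE BLOCK**: `off L x κ ≠ L − 1 → blk L (x + e_κ) = blk L x`. -/
theorem blk_add_unitVec_of_off_ne (hL : 1 ≤ L) (x : Site d) (κ : Fin d) (h : off L x κ ≠ L - 1) :
    blk L (x + unitVec κ) = blk L x := by
  have hb : off L x ∈ box d L := off_mem_box hL x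
  have hlt : off L x κ < L := by
    rw [AffineAveraging.box, Fintype.mem_piFinset] at hb
    exact Finset.mem_range.1 (hb κ)
  exact blk_add_unitVec_of_off_lt hL x κ (by omega)

/-- [folklore] **OFF THE NEAR FACE, THE BACKWARD BOND STAYS IN THE BLOCK**: `off L x κ ≠ 0 → blk L (x − e_κ) = blk L x`. -/
theorem blk_sub_unitVec_of_off_ne_zero (hL : 1 ≤ L) (x : Site d) (κ : Fin d) (h : off L x κ ≠ 0) :
    blk L (x - unitVec κ) = blk L x := by
  have hx : (L : ℤ) • blk L x + toSite (off L x) = x := blk_add_off hL x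
  have hb : off L x ∈ box d L := off_mem_box hL x
  have hb' : Function.update (off L x) κ (off L x κ - 1) ∈ box d L := by
    rw [AffineAveraging.box, Fintype.mem_piFinset] at hb ⊢
    intro i
    rw [Finset.mem_range]
    by_cases hi : i = κ
    · subst hi; rw [Function.update_self]; have := Finset.mem_range.1 (hb i); omega
    · rw [Function.update_of_ne hi]; exact Finset.mem_range.1 (hb i)
  have e1 : toSite (Function.update (off L x) κ (off L x κ - 1)) = toSite (off L x) - unitVec κ := by
    funext i
    simp only [toSite, Pi.sub_apply, unitVec_apply, Function.update_apply]
    split_ifs with hi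
    · subst hi
      have h1 : 1 ≤ off L x i := Nat.one_le_iff_ne_zero.2 h
      push_cast [Nat.cast_sub h1]; ring
    · simp
  have e : x - unitVec κ = (L : ℤ) • blk L x + toSite (Function.update (off L x) κ (off L x κ - 1)) := by
    rw [e1, ← add_sub_assoc, hx]
  rw [e, blk_block (blk L x) hb']

/-- [folklore] **OFF THE FACE LAYER, EVERY FORWARD BOND STAYS IN THE BLOCK**: if no coordinate offset of `x` is `0` or `L − 1` (the record's interior
predicate `¬P x`, `P x := ∃ i, off L x i = 0 ∨ off L x i = L − 1`), then `blk L (x + e_κ) = blk L x` for every `κ`. -/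
theorem blk_add_unitVec_of_not_face (hL : 1 ≤ L) (x : Site d) (h : ¬ ∃ i, off L x i = 0 ∨ off L x i = L - 1) (κ : Fin d) :
    blk L (x + unitVec κ) = blk L x := by
  push Not at h
  exact blk_add_unitVec_of_off_ne hL x κ (h κ).2

/-- [folklore] … and so does every backward bond. -/
theorem blk_sub_unitVec_of_not_face (hL : 1 ≤ L) (x : Site d) (h : ¬ ∃ i, off L x i = 0 ∨ off L x i = L - 1) (κ : Fin d) :
    blk L (x - unitVec κ) = blk L x := by
  push Not at h
  exact blk_sub_unitVec_of_off_ne_zero hL x κ (h κ).1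

end Geometry

/-! ## §2 `d = 3`: the road's dressed column at the HEAD's pin `G₀ := coDressKBmAt (ctr 4 n) n (KInvStep 3 n 0)`, split by the face layer -/

section Pin

variable (n : ℕ) [NeZero n]

/-- [our object] **«G0-COL-ENV-INTERIOR», PER DIRECTION**: at any site `x` whose offset in direction `α` is not `n − 1` (so the bond `(α, x)` stays in the block of `x`),
`|colH G₀ n μ y α x| ≤ ((n⁵)⁻¹·(8·C₄′·e^{κ′}))·e^{−(κ′∕(4n))|x − n•y|₁}`, `C₄′ := MD163 4·periodConst (kappa163 4) 3`, `κ′ := kappa163 4∕4` — d1-leaf-01 g30's L-h♭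
`DressedColumnRibbon.abs_colH_G₀_road_interior_le` BY NAME at the road's root `ctr 4 n = toSite (ctrOff 4 n)`, its bond hypothesis discharged by §1. -/
theorem abs_colH_G₀_pin_le_of_off_ne (μ : Fin (3 + 1)) (y : Site (3 + 1)) (α : Fin (3 + 1)) (x : Site (3 + 1)) (hx : off n x α ≠ n - 1) :
    |colH (coDressKBmAt (ctr 4 n) n (KInvStep (d := 3) n 0)) n μ y α x|
      ≤ ((((n : ℕ) : ℝ) ^ 5)⁻¹ * (8 * (MD163 4 * periodConst (kappa163 4) 3) * Real.exp (kappa163 4 / 4)))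
        * Real.exp (-(kappa163 4 / 4 / (4 * ((n : ℕ) : ℝ))) * l1 (x - ((n : ℕ) : ℤ) • y)) := by
  obtain ⟨m, rfl⟩ : ∃ m, n = m + 1 := ⟨n - 1, (Nat.succ_pred_eq_of_pos (Nat.pos_of_ne_zero (NeZero.ne n))).symm⟩
  have hn : 1 ≤ m + 1 := Nat.le_add_left 1 m
  exact abs_colH_G₀_road_interior_le m (ctrOff_mem_box (d := 3 + 1) hn) μ y α x (blk_add_unitVec_of_off_ne hn x α hx)

/-- [our object] **«G0-COL-ENV-INTERIOR» — TT29's `hint` BINDER VERBATIM** (`Ci := (n⁵)⁻¹·(8·C₄′·e^{κ′})`, `δ := κ′∕(4n)`, `P x := ∃ i, off n x i = 0 ∨ off n x i = n − 1`):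
`∀ α x, ¬P x → |colH G₀ n μ y α x| ≤ Ci * Real.exp (-δ * l1 (x - n•y))`. -/
theorem abs_colH_G₀_pin_interior_le (μ : Fin (3 + 1)) (y : Site (3 + 1)) :
    ∀ (α : Fin (3 + 1)) (x : Site (3 + 1)), ¬ (∃ i, off n x i = 0 ∨ off n x i = n - 1) →
      |colH (coDressKBmAt (ctr 4 n) n (KInvStep (d := 3) n 0)) n μ y α x|
        ≤ ((((n : ℕ) : ℝ) ^ 5)⁻¹ * (8 * (MD163 4 * periodConst (kappa163 4) 3) * Real.exp (kappa163 4 / 4)))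
          * Real.exp (-(kappa163 4 / 4 / (4 * ((n : ℕ) : ℝ))) * l1 (x - ((n : ℕ) : ℤ) • y)) := by
  intro α x hx
  push Not at hx
  exact abs_colH_G₀_pin_le_of_off_ne n μ y α x (hx α).2

/-- [our object] **«G0-COL-ENV» AT THE PIN, EVERY SITE** (`Cf := (n⁴)⁻¹·C_G′`, `C_G′ := C₄·(1 + 8(1 + e^{κ′}))·e^{κ′}`, `C₄ := MG163 4·periodConst (kappa163 4) 3`, same rate):
this lineage's g53 `PackedColumnEnvelope.abs_colH_G₀_road_le` BY NAME at the root `ctr 4 n`, block side re-indexed to `[NeZero n]`. -/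
theorem abs_colH_G₀_pin_le (μ : Fin (3 + 1)) (y : Site (3 + 1)) (α : Fin (3 + 1)) (x : Site (3 + 1)) :
    |colH (coDressKBmAt (ctr 4 n) n (KInvStep (d := 3) n 0)) n μ y α x|
      ≤ ((((n : ℕ) : ℝ) ^ 4)⁻¹ * ((MG163 4 * periodConst (kappa163 4) 3)
          * (1 + 8 * (1 + Real.exp (kappa163 4 / 4))) * Real.exp (kappa163 4 / 4)))
        * Real.exp (-(kappa163 4 / 4 / (4 * ((n : ℕ) : ℝ))) * l1 (x - ((n : ℕ) : ℤ) • y)) := by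
  obtain ⟨m, rfl⟩ : ∃ m, n = m + 1 := ⟨n - 1, (Nat.succ_pred_eq_of_pos (Nat.pos_of_ne_zero (NeZero.ne n))).symm⟩
  exact abs_colH_G₀_road_le m (ctrOff_mem_box (d := 3 + 1) (Nat.le_add_left 1 m)) μ y α x

/-- [our object] **TT29's `hface` BINDER VERBATIM** (any site predicate `P` — the face letter holds everywhere): `∀ α x, P x → |colH G₀ n μ y α x| ≤ Cf * Real.exp (-δ * l1 (x - n•y))`. -/
theorem abs_colH_G₀_pin_face_le (μ : Fin (3 + 1)) (y : Site (3 + 1)) (P : Site (3 + 1) → Prop) :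
    ∀ (α : Fin (3 + 1)) (x : Site (3 + 1)), P x →
      |colH (coDressKBmAt (ctr 4 n) n (KInvStep (d := 3) n 0)) n μ y α x|
        ≤ ((((n : ℕ) : ℝ) ^ 4)⁻¹ * ((MG163 4 * periodConst (kappa163 4) 3)
            * (1 + 8 * (1 + Real.exp (kappa163 4 / 4))) * Real.exp (kappa163 4 / 4)))
          * Real.exp (-(kappa163 4 / 4 / (4 * ((n : ℕ) : ℝ))) * l1 (x - ((n : ℕ) : ℤ) • y)) :=
  fun α x _ => abs_colH_G₀_pin_le n μ y α x

/-- [folklore] The interior weight is nonnegative (TT29's `hCi` slot). -/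
theorem pin_interior_weight_nonneg :
    0 ≤ ((((n : ℕ) : ℝ) ^ 5)⁻¹ * (8 * (MD163 4 * periodConst (kappa163 4) 3) * Real.exp (kappa163 4 / 4))) := by
  obtain ⟨m, rfl⟩ : ∃ m, n = m + 1 := ⟨n - 1, (Nat.succ_pred_eq_of_pos (Nat.pos_of_ne_zero (NeZero.ne n))).symm⟩
  have hMP : 0 ≤ (MD163 4 * periodConst (kappa163 4) 3) * Real.exp (kappa163 4 / 4) :=
    (mul_nonneg_iff_of_pos_left (by positivity)).1 (colH_KInvStep_zero_diff_road_weight_nonneg m)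
  have hMP' : 0 ≤ MD163 4 * periodConst (kappa163 4) 3 := (mul_nonneg_iff_of_pos_right (Real.exp_pos _)).1 hMP
  exact mul_nonneg (by positivity) (mul_nonneg (mul_nonneg (by norm_num) hMP') (Real.exp_pos _).le)

/-- [folklore] The face weight is nonnegative (TT29's `hCf` slot) — g53's `colH_G₀_road_weight_nonneg` re-indexed. -/
theorem pin_face_weight_nonneg :
    0 ≤ ((((n : ℕ) : ℝ) ^ 4)⁻¹ * ((MG163 4 * periodConst (kappa163 4) 3)
          * (1 + 8 * (1 + Real.exp (kappa163 4 / 4))) * Real.exp (kappa163 4 / 4))) := by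
  obtain ⟨m, rfl⟩ : ∃ m, n = m + 1 := ⟨n - 1, (Nat.succ_pred_eq_of_pos (Nat.pos_of_ne_zero (NeZero.ne n))).symm⟩
  exact colH_G₀_road_weight_nonneg m

omit [NeZero n] in
/-- [folklore] The common rate `κ′∕(4n)` is nonnegative (TT29's `hδ` slot). -/
theorem pin_rate_nonneg : 0 ≤ kappa163 4 / 4 / (4 * ((n : ℕ) : ℝ)) := by
  have := kappa163_pos 4
  positivity

/-- [folklore] **OFF THE FAR FACE THE COLUMN OBEYS BOTH LETTERS**, hence their minimum: `|colH G₀ n μ y α x| ≤ min Ci Cf · e^{−δ|x − n•y|₁}` whenever `off n x α ≠ n − 1`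
(no comparison of `MD163 4` with `MG163 4` is claimed — the `min` is read off the two letters at the same bond). -/
theorem abs_colH_G₀_pin_le_min_of_off_ne (μ : Fin (3 + 1)) (y : Site (3 + 1)) (α : Fin (3 + 1)) (x : Site (3 + 1)) (hx : off n x α ≠ n - 1) :
    |colH (coDressKBmAt (ctr 4 n) n (KInvStep (d := 3) n 0)) n μ y α x|
      ≤ min ((((n : ℕ) : ℝ) ^ 5)⁻¹ * (8 * (MD163 4 * periodConst (kappa163 4) 3) * Real.exp (kappa163 4 / 4)))
            ((((n : ℕ) : ℝ) ^ 4)⁻¹ * ((MG163 4 * periodConst (kappa163 4) 3)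
              * (1 + 8 * (1 + Real.exp (kappa163 4 / 4))) * Real.exp (kappa163 4 / 4)))
        * Real.exp (-(kappa163 4 / 4 / (4 * ((n : ℕ) : ℝ))) * l1 (x - ((n : ℕ) : ℤ) • y)) := by
  rw [min_mul_of_nonneg _ _ (Real.exp_pos _).le]
  exact le_min (abs_colH_G₀_pin_le_of_off_ne n μ y α x hx) (abs_colH_G₀_pin_le n μ y α x)

end Pin

end Summit.QuantumFields.BalabanUV.Beta.D1BFx.PackedColumnEnvelopeSplit

end
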